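import Literature.GroupTheory.CombinatorialGroupTheory.QuadraticWordsOneVertexSurfaceGroups
import Mathlib.Data.Fintype.Card
import HarnessLib

/-!
# One-vertex quadratic words with killed generators present surface groups

Topic `Literature/GroupTheory/CombinatorialGroupTheory`; continues
`QuadraticWordsOneVertexSurfaceGroups.lean` (Zieschang–Vogt–Coldewey, LNM 835, §3.1–3.2: a
one-vertex alternating quadratic word on `2h` symbols presents the surface group `S_h`).  The
Reidemeister–Schreier computation of a finite-index subgroup of a surface group (ZVC 4.14.1,
4.14.22) does not directly deliver such a word: its presentation `⟨κ ∣ W, (x_t)_{t ∈ T}⟩` keeps the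
edges of the Schreier spanning tree and the glued edges as KILLED generators `x_t = 1`, and the word
`W` uses exactly the remaining symbols.  This file removes the killed generators (the Tietze
transformation "delete a generator together with the relator killing it", ZVC 2.2.4):

* `nonempty_presentedGroup_kill` — `⟨κ ∣ W, (x_t)_{t ∈ T}⟩ ≅ ⟨κ ∖ T ∣ W⟩` when `W` avoids `T`
  (for `W` the image of a word `W'` over the subtype `{i // i ∉ T}`);
* `oneVertex_map_iff` — the vertex structure of a word is unchanged by an injective renaming of the
  symbols;
* `nonempty_presentedGroup_killed_mulEquiv_surfaceGroup` — **if `W` is a one-vertex alternating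
  quadratic word whose symbols are exactly `κ ∖ T` and `|κ| = 2h + |T|`, then
  `⟨κ ∣ W, (x_t)_{t ∈ T}⟩ ≅ S_h`.**

Theorems only.

## References

* H. Zieschang, E. Vogt, H.-D. Coldewey, *Surfaces and Planar Discontinuous Groups*, LNM 835,
  Springer 1980, 2.2.4, §3.1–3.2, 4.14.1, 4.14.22. [ZieschangVogtColdewey1980]
-/

namespace Literature.GroupTheory.CombinatorialGroupTheory

open List Literature.Topology.FourManifolds

/-! ### Killing generators that do not occur -/

section Kill

variable {κ : Type*} [DecidableEq κ] (T : Set κ) [DecidablePred (· ∈ T)]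

omit [DecidableEq κ] in
/-- The retraction `F(κ) → F(κ ∖ T)` killing the generators in `T`. [cite: ZieschangVogtColdewey1980, 2.2.4] -/
private theorem lift_kill_comp_map (T : Set κ) [DecidablePred (· ∈ T)] :
    (FreeGroup.lift fun i : κ => if h : i ∈ T then (1 : FreeGroup {i // i ∉ T}) else FreeGroup.of ⟨i, h⟩).comp
        (FreeGroup.map fun p : {i // i ∉ T} => p.val) = MonoidHom.id _ := by
  refine FreeGroup.ext_hom _ _ fun p => ?_
  rw [MonoidHom.comp_apply, FreeGroup.map.of, FreeGroup.lift_apply_of, dif_neg p.2, MonoidHom.id_apply]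

omit [DecidableEq κ] in
/-- **Killing generators** (ZVC 2.2.4): for a word `W'` over the symbols outside `T` and its image
`W` over `κ`, `⟨κ ∣ W, (x_t)_{t ∈ T}⟩ ≅ ⟨{i // i ∉ T} ∣ W'⟩`. [cite: ZieschangVogtColdewey1980, 2.2.4] -/
theorem nonempty_presentedGroup_kill (W' : List ({i // i ∉ T} × Bool)) :
    Nonempty (PresentedGroup ({FreeGroup.mk (W'.map (Prod.map Subtype.val id))} ∪ FreeGroup.of '' T) ≃*
      PresentedGroup ({FreeGroup.mk W'} : Set (FreeGroup {i // i ∉ T}))) := by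
  classical
  let φ : FreeGroup κ →* FreeGroup {i // i ∉ T} :=
    FreeGroup.lift fun i : κ => if h : i ∈ T then (1 : FreeGroup {i // i ∉ T}) else FreeGroup.of ⟨i, h⟩
  let ψ : FreeGroup {i // i ∉ T} →* FreeGroup κ := FreeGroup.map fun p : {i // i ∉ T} => p.val
  set W := W'.map (Prod.map Subtype.val id) with hW
  set S₁ : Set (FreeGroup κ) := {FreeGroup.mk W} ∪ FreeGroup.of '' T with hS₁
  set S₂ : Set (FreeGroup {i // i ∉ T}) := {FreeGroup.mk W'} with hS₂
  have hφψ : ∀ x, φ (ψ x) = x := fun x => by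
    change (φ.comp ψ) x = x; rw [show φ.comp ψ = MonoidHom.id _ from lift_kill_comp_map T]; rfl
  have hψW : ψ (FreeGroup.mk W') = FreeGroup.mk W := by rw [hW, FreeGroup.map.mk]; rfl
  have hφW : φ (FreeGroup.mk W) = FreeGroup.mk W' := by rw [← hψW, hφψ]
  have hφof : ∀ t ∈ T, φ (FreeGroup.of t) = 1 := fun t ht => by
    change FreeGroup.lift _ (FreeGroup.of t) = 1; rw [FreeGroup.lift_apply_of, dif_pos ht]
  -- `Φ : ⟨κ ∣ S₁⟩ → ⟨κ' ∣ S₂⟩`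
  have h₁ : ∀ r ∈ S₁, FreeGroup.lift (fun i => PresentedGroup.mk S₂ (φ (FreeGroup.of i))) r = 1 := by
    have e : FreeGroup.lift (fun i => PresentedGroup.mk S₂ (φ (FreeGroup.of i))) = (PresentedGroup.mk S₂).comp φ :=
      FreeGroup.ext_hom _ _ fun i => by simp
    rintro r (hr | ⟨t, ht, rfl⟩)
    · rw [Set.mem_singleton_iff] at hr
      subst hr
      rw [e, MonoidHom.comp_apply, hφW]
      exact PresentedGroup.one_of_mem rfl
    · rw [e, MonoidHom.comp_apply, hφof t ht, map_one]
  -- `Ψ : ⟨κ' ∣ S₂⟩ → ⟨κ ∣ S₁⟩`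
  have h₂ : ∀ r ∈ S₂, FreeGroup.lift (fun p : {i // i ∉ T} => PresentedGroup.mk S₁ (FreeGroup.of p.val)) r = 1 := by
    have e : FreeGroup.lift (fun p : {i // i ∉ T} => PresentedGroup.mk S₁ (FreeGroup.of p.val)) =
        (PresentedGroup.mk S₁).comp ψ :=
      FreeGroup.ext_hom _ _ fun p => by simp [ψ, FreeGroup.map.of]
    intro r hr
    rw [Set.mem_singleton_iff] at hr
    subst hr
    rw [e, MonoidHom.comp_apply, hψW]
    exact PresentedGroup.one_of_mem (Or.inl rfl)
  let Φ : PresentedGroup S₁ →* PresentedGroup S₂ := PresentedGroup.toGroup h₁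
  let Ψ : PresentedGroup S₂ →* PresentedGroup S₁ := PresentedGroup.toGroup h₂
  refine ⟨MonoidHom.toMulEquiv Φ Ψ (PresentedGroup.ext fun i => ?_) (PresentedGroup.ext fun p => ?_)⟩
  · rw [MonoidHom.comp_apply, MonoidHom.id_apply]
    rw [show Φ (PresentedGroup.of i) = PresentedGroup.mk S₂ (φ (FreeGroup.of i)) from PresentedGroup.toGroup.of h₁]
    by_cases hi : i ∈ T
    · rw [hφof i hi, map_one, map_one]
      exact (PresentedGroup.one_of_mem (Or.inr ⟨i, hi, rfl⟩)).symm
    · have : φ (FreeGroup.of i) = FreeGroup.of ⟨i, hi⟩ := by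
        change FreeGroup.lift _ (FreeGroup.of i) = _; rw [FreeGroup.lift_apply_of, dif_neg hi]
      rw [this]
      exact PresentedGroup.toGroup.of h₂
  · rw [MonoidHom.comp_apply, MonoidHom.id_apply]
    rw [show Ψ (PresentedGroup.of p) = PresentedGroup.mk S₁ (FreeGroup.of p.val) from PresentedGroup.toGroup.of h₂]
    change Φ (PresentedGroup.of p.val) = _
    rw [show Φ (PresentedGroup.of p.val) = PresentedGroup.mk S₂ (φ (FreeGroup.of p.val)) from
      PresentedGroup.toGroup.of h₁]
    have : φ (FreeGroup.of p.val) = FreeGroup.of p := by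
      change FreeGroup.lift _ (FreeGroup.of p.val) = _; rw [FreeGroup.lift_apply_of, dif_neg p.2]
    rw [this]
    rfl

end Kill

/-! ### Renaming the symbols keeps the vertices -/

section Rename

variable {κ κ' : Type*} [DecidableEq κ] [DecidableEq κ']

/-- The position of `g a` in `l.map g` is the position of `a` in `l`, for `g` injective. [folklore] -/
private theorem idxOf_map_of_injective {α β : Type*} [BEq α] [LawfulBEq α] [BEq β] [LawfulBEq β]
    {g : α → β} (hg : Function.Injective g) (l : List α) (a : α) : (l.map g).idxOf (g a) = l.idxOf a := by
  induction l with
  | nil => rfl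
  | cons b l ih =>
    by_cases h : b = a
    · subst h; rw [map_cons, idxOf_cons_self, idxOf_cons_self]
    · rw [map_cons, idxOf_cons_ne _ (fun e => h (hg e)), idxOf_cons_ne _ h, ih]

/-- Counting letters is unchanged by an injective renaming. [folklore] -/
private theorem count_map_of_injective' {α β : Type*} [BEq α] [LawfulBEq α] [BEq β] [LawfulBEq β]
    {g : α → β} (hg : Function.Injective g) (l : List α) (x : α) : (l.map g).count (g x) = l.count x := by
  induction l with
  | nil => rfl
  | cons b l ih =>
    rw [map_cons, count_cons, count_cons, ih]
    by_cases h : b = x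
    · subst h; simp
    · rw [beq_false_of_ne (fun e => h (hg e)), beq_false_of_ne h]

/-- Renaming the symbols injectively commutes with the vertex map (read on position values).
[cite: ZieschangVogtColdewey1980, 3.1.3] -/
theorem vertexMap_map_val (f : κ' → κ) (hf : Function.Injective f) (L : List (κ' × Bool))
    (k : Fin L.length) (k' : Fin (L.map (Prod.map f id)).length) (hk : k'.val = k.val) :
    (vertexMap (L.map (Prod.map f id)) k').val = (vertexMap L k).val := by
  have hg : Function.Injective (Prod.map f id : κ' × Bool → κ × Bool) := fun x y h => by
    obtain ⟨a, b⟩ := x; obtain ⟨c, d⟩ := y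
    simp only [Prod.map, id_eq, Prod.mk.injEq] at h
    exact Prod.ext (hf h.1) h.2
  -- predecessor positions agree
  have hpred : (predPos k').val = (predPos k).val := by
    simp only [predPos, length_map, hk]
  -- the letters at the predecessor positions correspond
  have hget : (L.map (Prod.map f id)).get (predPos k') = Prod.map f id (L.get (predPos k)) := by
    rw [get_eq_getElem, get_eq_getElem, getElem_map]
    congr 2
  simp only [vertexMap, partnerPos, hget, length_map]
  congr 1
  have e : ((Prod.map f id (L.get (predPos k))).1, !(Prod.map f id (L.get (predPos k))).2) =
      Prod.map f id ((L.get (predPos k)).1, !(L.get (predPos k)).2) := rfl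
  rw [e, idxOf_map_of_injective hg]

/-- Iterates of the vertex map under an injective renaming. [cite: ZieschangVogtColdewey1980, 3.1.3] -/
theorem iterate_vertexMap_map_val (f : κ' → κ) (hf : Function.Injective f) (L : List (κ' × Bool))
    (m : ℕ) (k : Fin L.length) (k' : Fin (L.map (Prod.map f id)).length) (hk : k'.val = k.val) :
    ((vertexMap (L.map (Prod.map f id)))^[m] k').val = ((vertexMap L)^[m] k).val := by
  induction m generalizing k k' with
  | zero => exact hk
  | succ m ih =>
    rw [Function.iterate_succ_apply, Function.iterate_succ_apply]
    exact ih _ _ (vertexMap_map_val f hf L k k' hk)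

/-- **Renaming the symbols keeps the vertices**: `OneVertex (L.map (f × id)) ↔ OneVertex L` for `f`
injective. [cite: ZieschangVogtColdewey1980, 3.1.3] -/
theorem oneVertex_map_iff (f : κ' → κ) (hf : Function.Injective f) (L : List (κ' × Bool)) :
    OneVertex (L.map (Prod.map f id)) ↔ OneVertex L := by
  have hlen : (L.map (Prod.map f id)).length = L.length := length_map _
  constructor
  · intro h k l
    obtain ⟨m, hm⟩ := h (Fin.cast hlen.symm k) (Fin.cast hlen.symm l)
    refine ⟨m, Fin.ext ?_⟩
    have := iterate_vertexMap_map_val f hf L m k (Fin.cast hlen.symm k) rfl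
    rw [hm] at this
    exact this.symm
  · intro h k' l'
    obtain ⟨m, hm⟩ := h (Fin.cast hlen k') (Fin.cast hlen l')
    refine ⟨m, Fin.ext ?_⟩
    have := iterate_vertexMap_map_val f hf L m (Fin.cast hlen k') k' rfl
    rw [hm] at this
    exact this

end Rename

/-! ### One-vertex words with killed generators present surface groups -/

section Assembly

variable {κ : Type*} [DecidableEq κ] [Fintype κ]

/-- **A one-vertex alternating quadratic word with killed generators presents a surface group**:
if `W` is a one-vertex alternating quadratic word over `κ` whose symbols are exactly those outside
`T`, and `|κ| = 2h + |T|`, then `⟨κ ∣ W, (x_t)_{t ∈ T}⟩ ≅ S_h` (ZVC Thm. 3.2.6 / 3.1.8 after the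
Tietze deletion 2.2.4 of the killed generators). [cite: ZieschangVogtColdewey1980, Thm 3.2.6 / 2.2.4] -/
theorem nonempty_presentedGroup_killed_mulEquiv_surfaceGroup {W : List (κ × Bool)} {T : Finset κ}
    (hq : IsQuadratic W) (hlive : ∀ i, (i, true) ∈ W ↔ i ∉ T) (hV : OneVertex W) {h : ℕ}
    (hcard : Fintype.card κ = 2 * h + T.card) :
    Nonempty (PresentedGroup ({FreeGroup.mk W} ∪ FreeGroup.of '' (↑T : Set κ)) ≃* SurfaceGroup h) := by
  classical
  -- every letter of `W` has its symbol outside `T`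
  have hWT : ∀ x ∈ W, x.1 ∉ T := by
    rintro ⟨i, b⟩ hx
    refine (hlive i).1 ?_
    cases b
    · exact hq.partner_mem hx
    · exact hx
  -- re-index `W` over the live symbols
  let κ' := {i // i ∉ (↑T : Set κ)}
  let W' : List (κ' × Bool) := W.attach.map fun x => (⟨x.1.1, by exact hWT x.1 x.2⟩, x.1.2)
  have hmap : W'.map (Prod.map Subtype.val id) = W := by
    rw [map_map]
    conv_rhs => rw [← attach_map_subtype_val W]
    rfl
  have hg : Function.Injective (Prod.map Subtype.val id : κ' × Bool → κ × Bool) := fun x y h => by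
    obtain ⟨a, b⟩ := x; obtain ⟨c, d⟩ := y
    simp only [Prod.map, id_eq, Prod.mk.injEq] at h
    exact Prod.ext (Subtype.ext h.1) h.2
  -- the re-indexed word is one-vertex alternating quadratic on all of `κ'`
  have hq' : IsQuadratic W' := by
    intro i
    have e1 := count_map_of_injective' hg W' (i, true)
    have e2 := count_map_of_injective' hg W' (i, false)
    rw [hmap] at e1 e2
    have hqi := hq i.val
    change W.count (i.val, true) = W'.count (i, true) at e1
    change W.count (i.val, false) = W'.count (i, false) at e2
    rw [e1, e2] at hqi
    -- the two `BEq (κ' × Bool)` instances (via `Subtype.instBEq` / via `DecidableEq`) agree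
    convert hqi
  have hall' : ∀ i : κ', (i, true) ∈ W' := by
    intro i
    have hi : (i.val, true) ∈ W'.map (Prod.map Subtype.val id) := by rw [hmap]; exact (hlive i.val).2 i.2
    obtain ⟨x, hx, hxe⟩ := mem_map.1 hi
    have : x = (i, true) := hg (by rw [hxe]; rfl)
    exact this ▸ hx
  have hV' : OneVertex W' := (oneVertex_map_iff Subtype.val Subtype.val_injective W').1 (hmap ▸ hV)
  have hcard' : Fintype.card κ' = 2 * h := by
    have e : Fintype.card κ' = Fintype.card κ - Fintype.card {i // i ∈ (↑T : Set κ)} :=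
      Fintype.card_subtype_compl _
    rw [e, hcard]
    simp
  obtain ⟨e₁⟩ := hV'.nonempty_presentedGroup_mulEquiv_surfaceGroup_of_card hq' hall' hcard'
  obtain ⟨e₀⟩ := nonempty_presentedGroup_kill (↑T : Set κ) W'
  rw [hmap] at e₀
  exact ⟨e₀.trans e₁⟩

end Assembly

end Literature.GroupTheory.CombinatorialGroupTheory
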